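import Mathlib
import HarnessLib
import Summits.ABC.ABC.Theses.DefiniteXi
import Literature.NumberTheory.EllipticCurves.HeegnerPoints
import Literature.NumberTheory.EllipticCurves.BSDHeegnerPoints

/-!
# Sketch — crux-ideate stmt-ABC-11337 (XiStrongBound), ideator 1, round 1

First lemmas of the two idea cards (statements only; `sorry` proofs are placeholders —
the crux-plan stage turns them into registered stubs).

* Card `eisenstein-part-quarantine`: `EisQuarantine → IrrCore → TBound → XiStrongBound`
  (pure real arithmetic: ξ = (2·3-part) · (part coprime to 6)).
* Card `cd-heegner-collision-sieve`: `HeegnerHeightBound → GrossZagier → covolume lower bound`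
  on Frey curves of analytic rank ≤ 1 over a Heegner field.
-/

namespace Summit.ABC.ABC.Cruxes.XiStrongBound.Sketch

open Literature.NumberTheory.EllipticCurves Literature.NumberTheory.Automorphic
open Literature.NumberTheory.EllipticCurves.ModularForms

noncomputable section

/-- The `{2,3}`-primary part of a natural number (`1` for `n = 0`). -/
def sixPart (n : ℕ) : ℕ := 2 ^ (n.factorization 2) * 3 ^ (n.factorization 3)

/-- The part of `n` coprime to `6` (`0` for `n = 0`). -/
def coprimeSixPart (n : ℕ) : ℕ := n / sixPart n

/-- The crux's ξ for the Frey curve `E_(a,b)` at the admissible pair `(N/Nm, Nm)`. -/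
def xiFrey (a b : ℤ) (N Nm : ℕ) : ℕ :=
  brandtXi (N / Nm) Nm (fun n => (freyCurve a b).LFunction n)

/-- `∏_{q ∣ Nm} v_q(Δ_min(E_(a,b)))` — the level-lowering (component-group) factor of the crux. -/
def tamExp (a b : ℤ) (Nm : ℕ) : ℕ :=
  ∏ q ∈ Nm.primeFactors, ((freyCurve a b).minimalDiscriminantNorm ℤ).factorization q

/-- `T_odd(E) = ∏_{q ∣ N, q odd} v_q(Δ_min)` — the product over ALL odd bad primes
(Ribet–Takahashi–Pasten's `T(E)`; bounded by `N^(8/3+ε)` unconditionally, tree fact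
`pasten2024_thm_2_5`). -/
def oddTamExp (a b : ℤ) (N : ℕ) : ℕ :=
  ∏ q ∈ N.primeFactors.erase 2, ((freyCurve a b).minimalDiscriminantNorm ℤ).factorization q

/-! ### Card B — `eisenstein-part-quarantine` -/

/-- **EisQuarantine** (the card's new target): the `{2,3}`-part of the definite congruence
number of a Frey curve is `≪ N^ε · T_odd(E)^B` for an absolute `B ≥ 0`, at every admissible
`N⁻` — level-lowering congruences at odd primes are paid by `T_odd`, the Eisenstein/2-adic
congruences with all-odd-new forms are claimed sub-polynomial. -/
def EisQuarantine : Prop :=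
  ∃ B : ℝ, 0 ≤ B ∧ ∀ ε : ℝ, 0 < ε → ∃ C : ℝ, ∀ a b : ℤ, IsCoprime a b → a * b * (a + b) ≠ 0 →
    ∀ (N : ℕ) [NeZero N], (freyCurve a b).conductorNorm ℤ = N →
    ∀ Nm : ℕ, Odd Nm → Squarefree Nm → Odd Nm.primeFactors.card → Nm ∣ N →
      (sixPart (xiFrey a b N Nm) : ℝ) ≤ C * (N : ℝ) ^ ε * (oddTamExp a b N : ℝ) ^ B

/-- **IrrCore** (the residual abc-hard statement, now supported only at primes `ℓ ≥ 5`, where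
`ρ̄_(E,ℓ)` is irreducible for Frey curves and `ξ[ℓ] = #Sel_St(Ad⁰ ρ_(E,ℓ))` by the
Diamond/Böckle–Khare–Manning numerical criterion): the prime-to-6 part of `ξ` times the
level-lowering factor is `≪ N^(2+ε)`. -/
def IrrCore : Prop :=
  ∀ ε : ℝ, 0 < ε → ∃ C : ℝ, ∀ a b : ℤ, IsCoprime a b → a * b * (a + b) ≠ 0 →
    ∀ (N : ℕ) [NeZero N], (freyCurve a b).conductorNorm ℤ = N →
    ∀ Nm : ℕ, Odd Nm → Squarefree Nm → Odd Nm.primeFactors.card → Nm ∣ N →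
      (coprimeSixPart (xiFrey a b N Nm) : ℝ) * (tamExp a b Nm : ℝ) ≤ C * (N : ℝ) ^ (2 + ε)

/-- **TBound** (`T_odd(E) ≪ N^ε` on Frey curves; = RibetTakahashiSplit's
`ManyPrimeValuationProduct ∧ FewPrimeValuationProduct`, a consequence of Szpiro, open; Pasten
proves exponent `8/3 + ε`). -/
def TBound : Prop :=
  ∀ ε : ℝ, 0 < ε → ∃ C : ℝ, ∀ a b : ℤ, IsCoprime a b → a * b * (a + b) ≠ 0 →
    ∀ (N : ℕ) [NeZero N], (freyCurve a b).conductorNorm ℤ = N →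
      (oddTamExp a b N : ℝ) ≤ C * (N : ℝ) ^ ε

/-- **First lemma of card B**: the three-way split of the crux. Pure arithmetic:
`ξ = sixPart ξ · coprimeSixPart ξ`, exponents `ε/(2+B)` on each factor. -/
theorem xiStrongBound_of_split :
    EisQuarantine → IrrCore → TBound → Summit.ABC.ABC.Theses.DefiniteXi.XiStrongBound := by
  sorry

/-! ### Card A — `cd-heegner-collision-sieve` -/

/-- **HeegnerHeightBound**: for a Frey curve of conductor `N`, an imaginary quadratic `K` with the
Heegner hypothesis and odd `d_K`, every Heegner point `P ∈ E(K)` has canonical height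
`ĥ_K(P) ≤ C · N^(1+ε) · √|d_K| · |L'(E/K,1)|` (normalisations of the tree's
`GrossZagierFormula`: `ĥ_K` = twice the height over `ℚ`). By Gross–Zagier this is EQUIVALENT to
the covolume lower bound `covol(Λ_E) ≥ c N^(−1−ε)` (Szpiro in period form) whenever
`L'(E/K,1) ≠ 0`. -/
def HeegnerHeightBound : Prop :=
  ∀ ε : ℝ, 0 < ε → ∃ C : ℝ, ∀ a b : ℤ, IsCoprime a b → a * b * (a + b) ≠ 0 →
    ∀ (N : ℕ) [NeZero N], (freyCurve a b).conductorNorm ℤ = N →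
    ∀ (K : Type) [Field K] [NumberField K], IsImaginaryQuadratic K →
      SatisfiesHeegnerHypothesis N K → Odd (NumberField.discr K) →
      ∀ P : ((freyCurve a b).baseChange K).toAffine.Point, IsHeegnerPoint N (freyCurve a b) K P →
        P.canonicalHeight ≤
          C * (N : ℝ) ^ (1 + ε) * Real.sqrt |(NumberField.discr K : ℝ)| * ‖LDerivEK (freyCurve a b) K‖

/-- Covolume lower bound for Frey curves possessing a non-torsion Heegner point (analytic rank of
`E/K` equal to `1` for some Heegner field `K`): the period-lattice form of Szpiro,
`covol(Λ_E) ≥ c · N^(−(1+ε))`, for every parametrisation datum (the quotient `covol/c²` is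
datum-independent; `c² ≥ 1`). -/
def FreyCovolLowerBoundRankOne : Prop :=
  ∀ ε : ℝ, 0 < ε → ∃ c : ℝ, 0 < c ∧ ∀ a b : ℤ, IsCoprime a b → a * b * (a + b) ≠ 0 →
    ∀ (N : ℕ) [NeZero N], (freyCurve a b).conductorNorm ℤ = N →
    ∀ Dt : ModularParametrizationData (freyCurve a b) N,
      (∃ (K : Type) (_ : Field K) (_ : NumberField K), IsImaginaryQuadratic K ∧
        SatisfiesHeegnerHypothesis N K ∧ Odd (NumberField.discr K) ∧
        ∃ P : ((freyCurve a b).baseChange K).toAffine.Point,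
          IsHeegnerPoint N (freyCurve a b) K P ∧ P.canonicalHeight ≠ 0) →
      c * (N : ℝ) ^ (-(1 + ε)) ≤ ZLattice.covolume Dt.L.lattice

/-- **First lemma of card A**: Heegner height bound + Gross–Zagier ⟹ the covolume (Szpiro)
lower bound on Frey curves of Heegner rank one. Proof plan: `L' = (2 covol/(c² u² √D)) ĥ(P)`,
`ĥ(P) > 0`, so `covol = L' c² u² √D / (2 ĥ) ≥ c² u² / (2C) · N^(−1−ε) ≥ N^(−1−ε)/(2C)`. -/
theorem freyCovolLowerBound_of_heegnerHeightBound :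
    HeegnerHeightBound →
    (∀ a b : ℤ, ∀ (N : ℕ) [NeZero N], (freyCurve a b).conductorNorm ℤ = N →
      ∀ (K : Type) [Field K] [NumberField K], IsImaginaryQuadratic K →
        SatisfiesHeegnerHypothesis N K → GrossZagierFormula N (freyCurve a b) K) →
    FreyCovolLowerBoundRankOne := by
  sorry

end

end Summit.ABC.ABC.Cruxes.XiStrongBound.Sketch
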